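import Summits.QuantumFields.YangMills.Theorems.BalabanUVNodesN08AtRecord13CoPH
import Literature.MathematicalPhysics.QuantumFieldTheory.Balaban1983to89.Node00.Record13SepCoPH
import Literature.MathematicalPhysics.QuantumFieldTheory.Balaban1983to89.Node00.Record13CarriersSepCoPH
import Literature.MathematicalPhysics.QuantumFieldTheory.Balaban1983to89.Node00.Record13ResidualsR

/-!
# BalabanUVNodes ∕ N08 AT THE v1.7 STAGE-13 RECORD OF RECORD (separated (7)-regular range, print's background, history-indexed residual 𝐓-weights) — v1.7 `CoPH` EDITION OF RECORD 13 (director-ym LINE №183 RULING H1ʰ ∕ №186 (α) ∕ №187; FINDING №9 = node00-def-T LOCATED-9 «the v1.6 residual 𝐓-weight slot `Stage13RParams.Zr p`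
is run-indexed but HISTORY-BLIND, while print's ζ(Ω^c_{k+1}) ([Balaban1988Convergent] p.267 L15–20, (3.23) p.270) reads the term's whole history (Ω_j, Λ_j)»): def-T FILE 27 `Node00/Record13CoPH`
(p537939 ✓ 2668afee4a5b: `structure Stage13HParams extends Stage13RParams` + history-indexed fields `Zh p n Ω Λ : TkResidualW F N (FluctV N) p.K` (level-indexed, read AT THE WHOLE HISTORY `θ.zhAt p s = θ.Zh p n s.Ω s.Λ`)
and `Phih` (history-indexed smearing functions of the residual §2 data, C2 fold №187), guard `ZhUnity`, weights `WtOfRecord₁₃H θ p s`, provisos `Stage13HParams.Provisos₁₃CoPH` (Core rows +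
`zhLaws ∕ zhLocal`), view `toStage5₁₃CoPH`, datum `datumOfRecord₁₃CoPH`, record `IsRecordOfRecord₁₃CCoPH` + faces; THE DOOR `Stage13HParams.ofHistoryBlind θ := ⟨θ, fun p _ _ _ => θ.Zr p, fun p _ _ _ => (θ.Rz p.K).phi⟩`
+ `rfl` ∕ `Iff.rfl` faces + dot-forms `Stage13RParams.ZrUnity.ofHistoryBlind ∕ ….Provisos₁₃(Sep)CoPR.ofHistoryBlind`) and FILE 28T `Node00/Record13SepCoPH` (p539169 ✓ df011462f50f: `Provisos₁₃SepCoPH`, `datumOfRecord₁₃SepCoPH`,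
`IsRecordOfRecord₁₃CSepCoPH` + `.toCoPH`); dag-n10-d's H carrier leaves `Node00/Record13CarriersCoPH` (p539476 ✓ 944d848ee41f: §0 THE H-PIN ALGEBRA `Stage13HParams.onBase ∕ rebindX ∕ pin<G>` (structure updates
keeping `Zh ∕ Phih`), `toStage5₁₃CoPH_rebindX ∕ _pin<G>`, `Provisos₁₃CoPH.rebindX ∕ .pin<G>`, `datumOfRecord₁₃CoPH_rebindX ∕ _pin<G>`, `isRecordOfRecord₁₃CCoPH_rebindX ∕ _pinB10_of_eq`, `exists_world_…_rebindX`,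
`guard_rebindX_iff`, H views `view₁₃CoPHB10YZW ∕ …B8B10YZW` + `_eq` + `_leaves`, §6 door-commute faces) and `…/Record13CarriersSepCoPH` (p540513 ✓ 81f7bc100561: `Provisos₁₃SepCoPH.pin<G>`, `datumOfRecord₁₃SepCoPH_pin<G>`,
`isRecordOfRecord₁₃CSepCoPH_pinB10_of_eq`).  Token map T₇ (plan IMPACT-183 + AMENDMENT (α), def-T KEYMAP v1.7, dag-lead WORDS): «the v1.6 names with `CoPR ↦ CoPH`, binders `Stage13RParams ↦ Stage13HParams`, `ZrUnity ↦ ZhUnity`, rows `zrLaws ∕ zrLocal ↦ zhLaws ∕ zhLocal`, `WtOfRecord₁₃R θ p ↦ (s ↦ WtOfRecord₁₃H θ p s)`».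
# THIS FILE = the T₇ image of ★ ROW A2's v1.6 edition `BalabanUVNodesN08AtRecord13SepCoPR` (p532676: N08's ₁₃ ∃-currency at the record plan's items key on) (Track A, DAG node N08 [Balaban1985UV3] CMP **102** (1985) 255, Thm 1 p. 257 (compact reading) + Thm 2 p. 272; R134 fan-out seat `pub-ymgap-dag-n08-c` g17, strategy s2
«knit at the record of record», trigger (t31) = FINDING №9 ∕ №174 (3) «pens port their OWN files»; 2026-08-27)

WHY THIS FILE.  Route «BalabanUVNodes» re-keys ⁶ → ⁷ (plan rev 24∕25, IMPACT-183) on FILE 28T's names by the PURE token map T₇: the K0⁷ text reads `∃ θ : Stage13HParams F 2,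
θ.Provisos₁₃SepCoPH F 2 ∧ (θ.ZhUnity F 2 ∧ θ.SlotsNondegenerate₁₃ F 2) ∧ θ.Admissible F 2`, and the K1⁷ rung 1 (plan K1 skeleton v5 = T₇(v4)) PINS NODE N08 BY NAME as `Node00.PrintedUV3V 2 θ.L`
over the S-bound class `RecordS`.  p532676 is keyed on the ⁶ names — NOT instantiable from `h : θ.Provisos₁₃SepCoPH F N` (only the history-blind door goes ⁶ → ⁷) — so the ∃-CURRENCY is
re-typed here as its IMAGE under T₇ (20 ∕ 20); the POINTED closers ∕ §0 guards ∕ guard-per-pin faces are the CoPH storey's (`N08AtRecord13CoPH` §1 ∕ §0 along `.toCoPH` ∕ §0a).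
HONEST DEPARTURES FROM A PURE TOKEN IMAGE (generator `tools/coph_n08_gen.py`; every other statement SHAPE verbatim under T₇, proofs re-checked):
(i) the 𝐑-bundle `WOfRecord₁₃` (12a; reads no 𝐓-slot, NOT re-issued) is fed the base `θ.toStage13Params`, as at ⁶; (ii′) every WITNESS-LINE theorem is stated at the H-LIFT
`⟨⟨θ₀, Zr⟩, Zh, Phih⟩ : Stage13HParams F N` of node00-def-K0a's v1.5 maker `θ₀` (`theta13LiveOfRecord ∕ theta13LiveOfNumerics … ∕ theta13LiveOfFamily₂ …`, θ-level, background-free)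
by an ARBITRARY run-indexed residual family `Zr` AND ARBITRARY history-indexed fields `Zh ∕ Phih` (FILE 27's field tuple; so K0a's history-blind ⁷ witnesses `ofHistoryBlind ⟨θ₀, Zr₀⟩`
AND any future VALUE pin of `Zh` instantiate them by `exact`); admissibility and `SlotsNondegenerate₁₃` of the lift ARE K0a's faces of `θ₀` through the base (definitional), while the
guard half `ZhUnity` is DISPLAYED as `hZ` in the `N = 2` forms; (iii) the two ⁶ forms `…_at_ZrOfRecord₁₃` become `…_at_ofHistoryBlind_ZrOfRecord₁₃`, stated AT THE DOOR
`Stage13HParams.ofHistoryBlind F 2 ⟨θL, ZrOfRecord₁₃ F 2 θL⟩` (= `ofHistoryBlind (Stage13RParams.ofCured F 2 θL)` of K0a's `Record13SepCoPRInhabitedOfSepCoP` §2, by `rfl`): there the v1.7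
guard `ZhUnity` IS the cured R-lift's `ZrUnity` through def-T's `Stage13RParams.ZrUnity.ofHistoryBlind`, hence HYPOTHESIS-FREE by FILE 17 `finsum_ζ0_ZrOfRecord₁₃` (every generation, every run).

WHAT IS PROVED (all bookkeeping BY NAME, one `exact`∕`obtain` each):
* §0 the in-edge guards at every run of every ₁₃CSepCoPH record, hence N08 there reads `b8 → b9 → b11 → b10`; §0b the v1.7 record over the [B10]-PINNED and over the FOUR-PIN H view at
  `datumOfRecord₁₃SepCoPH θ h` (n10-d's `Provisos₁₃SepCoPH.pin<G>`, `datumOfRecord₁₃SepCoPH_pin<G>`, `isRecordOfRecord₁₃CSepCoPH_pinB10_of_eq`, `view₁₃CoPHB10YZW_eq`) + existence, any window;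
* §2 THE ∃-CURRENCY: from `θ`, `h : θ.Provisos₁₃SepCoPH F N`, admissibility and `PrintedUV3V N θ.L` — a ₁₃CSepCoPH record of `datumOfRecord₁₃SepCoPH θ h` bound over the pinned ∕ four-pin
  H view, carrying N08 at every run; the PINNED and FOUR-PIN PRESENTATIONS (pin returned AT the presenting parameter); «THE K0⁷ ANTECEDENT + the slot at every odd `L > 1` ⟹ N08's
  conjunct of rung 1 WITH ITS PIN» (`…_of_inhabited13SepCoPH`; `_two` at `N = 2`, hypothesis = the K0⁷ body at `F` VERBATIM); §2S THE S-BOUND SLICE OF THE REGISTERED RUNG 1 v5: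
  `exists_worldS₁₃CSepCoPH_b10_main_of_slot` (an S-bound world IN THE S-CLASS `RecordS F θ h w` — body inlined — carrying N08, from the slot) and ★ `exists_guarded_recordS₁₃CSepCoPH_b10_main_of_inhabited13SepCoPH_two`;
* §3 on the H-lifts of the WITNESS LINE OF RECORD `θ₁₃ = theta13LiveOfRecord F N` (`L = F.L`, `γ = 1∕2`): N08's share costs `hP : Provisos₁₃SepCoPH` there (HYPOTHESIS, opaque) +
  `PrintedUV3V N F.L` (+ `hZ` at `N = 2`); §4 the same at the H-lifts of K0a's all-numerics family `theta13LiveOfNumerics n ε₂₉ …` (`γ = n.γ`) — incl. THE DOOR FORM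
  `…_two_at_ofHistoryBlind_ZrOfRecord₁₃` at `ofHistoryBlind ⟨θL, ZrOfRecord₁₃ F 2 θL⟩` with the guard HYPOTHESIS-FREE — and two-letter family `theta13LiveOfFamily₂ ε₀ ε₂₉ …` (`γ = 1∕2`); provisos OPAQUE throughout (no `bg` socket text: the ⁷ socket is node00-def-K0a's).

HONEST FRAMING.  Count-neutral kernel bookkeeping BY NAME — a re-keying of a LANDED storey to the re-issued record (new file; p532676 stays as the ⁶ sibling of record).  NOT A
DISCHARGE OF N08: `PrintedUV3V` is TYPED and DISPLAYED as a hypothesis (resp. returned as the pin), NOT PROVED — an inhabitant (the [B10] cluster expansion at print's run objects)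
remains THE object gap; `Provisos₁₃(Sep)CoPH`, admissibility and the guard are hypotheses or K0a's theorems, never asserted; K0 ∕ K1 neither proved nor assumed; nothing of
Bałaban's asserted; a re-key is not progress; one finite four-torus per run at fixed `ε`, [B10]'s d = 3 lattices inside the record; nothing continuum ∕ ℝ⁴ ∕ OS ∕ mass gap ∕ Clay.  0 `sorry`, 0 `def`, standard axioms.
Sources: [Balaban1985UV3] Thm 1 p.257, Thm 2 p.272; [Balaban1989LargeFieldII] Thm 1 + (0.1) pp.355–356; [Balaban1988Convergent] (1.11) p.248, (2.18) p.257, (2.28) p.259, p.267,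
(3.16)–(3.23) pp.268–270; [Balaban1985Variational] (5)–(7) p.278; [Balaban1985RegularSpaces] (1.3)–(1.9) pp.76–77, Thm 8 p.101; [Balaban1987RG1] (0.21) p.256, (2.9) p.266.
-/

noncomputable section

namespace Summit.QuantumFields.YangMills.BalabanUVNodes.N08AtRecord13SepCoPH

open Literature.MathematicalPhysics.QuantumFieldTheory.Balaban1983to89
open Literature.MathematicalPhysics.QuantumFieldTheory.Balaban1983to89.T4Continuum (T4Family FiniteEpsData)
open Literature.MathematicalPhysics.QuantumFieldTheory.Balaban1983to89.DagBinding (WorldP leavesP PrintedCarriersR PrintedCarriers9X PrintedCarriers11 PrintedCarriers15)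
open Literature.MathematicalPhysics.QuantumFieldTheory.Balaban1983to89.Node00
open Summit.QuantumFields.YangMills.BalabanUVNodes.N08AtRecord13CoPH
open scoped Matrix.Norms.L2Operator

variable {F : T4Family} {N : ℕ} [NeZero N]

/-! ## §0 THE IN-EDGE GUARDS AT EVERY RUN OF EVERY v1.7 STAGE-13 RECORD — keyed once on the core (`.toCoPH`) -/

section Guards
variable {D : FiniteEpsData F (SU N)} {w : WorldP}

/-- **In-edge guards at every run of a ₁₃CSepCoPH record**: the leaves `b4`, `b5`, `b6`, `b7` HOLD — N01 ∕ N02 ∕ N03 ∕ N04 are NODE 00 theorems at the Stage-5 shadow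
(`Node00.b4∕b5∕b7_main_of_isRecordOfRecord₅C`, `Node00.N03_at_record₅C`), read through `IsRecordOfRecord₁₃CSepCoPH.toCoPH` from the CoPH storey's `N08AtRecord13CoPH.guards_of_isRecordOfRecord₁₃CCoPH` (FILE 27's `atWorld_of_isRecordOfRecord₁₃CCoPH`).
[cite: Balaban1983RegularityDecay, Theorem p.573; Balaban1984PropagatorsI, Props. 1.1–1.2 pp.33–36; Balaban1984PropagatorsII, Lemma 2.1 – Cor. 2.8 pp.234–249; Balaban1985Averaging, Props. 1–10 pp.26–50 (kernel versions at the objects of record; bookkeeping, transferred)] -/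
theorem guards_of_isRecordOfRecord₁₃CSepCoPH (h : IsRecordOfRecord₁₃CSepCoPH F N D w) (P : B12.RunParams) :
    (leavesP w P).b4 ∧ (leavesP w P).b5 ∧ (leavesP w P).b6 ∧ (leavesP w P).b7 :=
  guards_of_isRecordOfRecord₁₃CCoPH h.toCoPH P

/-- Hence at a ₁₃CSepCoPH record N08 reads `b8 → b9 → b11 → b10` (the in-edges `b5 b6 b7` drop out). [cite: Balaban1985UV3, Thm 1 p.257, Thm 2 p.272 (bookkeeping)] -/
theorem b10_main_iff_residual_of_isRecordOfRecord₁₃CSepCoPH (h : IsRecordOfRecord₁₃CSepCoPH F N D w) (P : B12.RunParams) :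
    Dag.B10_main (leavesP w P) ↔ ((leavesP w P).b8 → (leavesP w P).b9 → (leavesP w P).b11 → (leavesP w P).b10) :=
  b10_main_iff_residual_of_isRecordOfRecord₁₃CCoPH h.toCoPH P

end Guards

/-! ## §0b THE v1.7 RECORD OVER THE [B10]-PINNED ∕ FOUR-PIN CoPH VIEW, over dag-n10-d's leaf `Node00/Record13CarriersSepCoPH` v1.7 twins
(`Provisos₁₃SepCoPH.pin<G>`, `datumOfRecord₁₃SepCoPH_pin<G>`, `isRecordOfRecord₁₃CSepCoPH_pinB10_of_eq`) BY NAME; the guard and admissibility faces per pin are θ-level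
(p491313 §0b `guard_pin<G>_iff`, n10-d `Stage13HParams.pin<G>_admissible_iff`, all `Iff.rfl`) and serve verbatim -/

section PinFaces
variable (θ : Stage13HParams F N)

/-- **EVERY admissible Stage-13 parameter with v1.7 provisos presents a ₁₃CSepCoPH record at its own datum whose world is bound over the [B10]-PINNED CoPH view**,
any window `0 < γw ≤ θ.γ`, block size `θ.L` (def-T's world construction at `θ.pinB10`, through n10-d's `isRecordOfRecord₁₃CSepCoPH_pinB10_of_eq`). [cite: Balaban1989LargeFieldII, Thm 1 + (0.1) pp.355–356 (bookkeeping)] -/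
theorem exists_world_isRecordOfRecord₁₃CSepCoPH_pinB10 (h : θ.Provisos₁₃SepCoPH F N) (hθ : θ.Admissible F N) {γw : ℝ} (hγw : 0 < γw ∧ γw ≤ θ.γ) :
    ∃ w : WorldP, IsRecordOfRecord₁₃CSepCoPH F N (datumOfRecord₁₃SepCoPH F N θ h) w ∧ w.γ = γw ∧ w.L = (θ.L : ℝ) ∧
      ∀ P, w.up P = upOfRecord₅C F N ((θ.pinB10 F N).toStage5₁₃CoPH F N) P := by
  obtain ⟨w₀⟩ := nonempty_worldP
  exact ⟨{ w₀ with
      C := (datumOfRecord₁₃SepCoPH F N θ h).C, γ := γw, L := (θ.L : ℝ), one_lt_L := by exact_mod_cast θ.hL.2,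
      up := fun P => upOfRecord₅C F N ((θ.pinB10 F N).toStage5₁₃CoPH F N) P },
    isRecordOfRecord₁₃CSepCoPH_pinB10_of_eq F N θ h hθ _ rfl hγw rfl (fun _ => rfl), rfl, rfl, fun _ => rfl⟩

/-- **A world with def-T's pointed clauses bound over n10-d's FOUR-PIN Stage-13 view IS a ₁₃CSepCoPH record AT `datumOfRecord₁₃SepCoPH θ h`** (presenting parameter the quadruply
pinned `θ`; v1.7 provisos transported pin by pin, datum by the four `rfl`s, view by `view₁₃CoPHB10YZW_eq` — p514601 §0b re-keyed).
[cite: Balaban1989LargeFieldII, Thm 1 + (0.1) pp.355–356 (bookkeeping)] -/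
theorem isRecordOfRecord₁₃CSepCoPH_view₁₃CoPHB10YZW_of_eq (h : θ.Provisos₁₃SepCoPH F N) (hθ : θ.Admissible F N) (Mstar : ℕ) (ops : OpsY N θ.toStage3Params Mstar)
    (ζ : ResidZ F N) (lamW : ResidW F N) (w : WorldP) (hC : w.C = (datumOfRecord₁₃SepCoPH F N θ h).C) (hγ : 0 < w.γ ∧ w.γ ≤ θ.γ) (hL : w.L = (θ.L : ℝ))
    (hup : ∀ P, w.up P = upOfRecord₅C F N (θ.view₁₃CoPHB10YZW F N Mstar ops ζ lamW) P) :
    IsRecordOfRecord₁₃CSepCoPH F N (datumOfRecord₁₃SepCoPH F N θ h) w := by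
  have h₁ : (θ.pinB10 F N).Provisos₁₃SepCoPH F N := h.pinB10
  have h₂ : ((θ.pinB10 F N).pinY F N (Y9OfRecord N θ.toStage3Params Mstar ops)).Provisos₁₃SepCoPH F N := h₁.pinY _
  have h₃ : (((θ.pinB10 F N).pinY F N (Y9OfRecord N θ.toStage3Params Mstar ops)).pinZ F N (Z11OfRecord F N ζ)).Provisos₁₃SepCoPH F N := h₂.pinZ _
  have h₄ : ((((θ.pinB10 F N).pinY F N (Y9OfRecord N θ.toStage3Params Mstar ops)).pinZ F N (Z11OfRecord F N ζ)).pinW F N (WOfRecord₁₃ F N θ.toStage13Params lamW)).Provisos₁₃SepCoPH F N :=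
    h₃.pinW _
  have hθ' : ((((θ.pinB10 F N).pinY F N (Y9OfRecord N θ.toStage3Params Mstar ops)).pinZ F N (Z11OfRecord F N ζ)).pinW F N (WOfRecord₁₃ F N θ.toStage13Params lamW)).Admissible F N :=
    (Stage13Params.pinW_admissible_iff F N _ _).2 ((Stage13Params.pinZ_admissible_iff F N _ _).2
      ((Stage13Params.pinY_admissible_iff F N _ _).2 ((Stage13Params.pinB10_admissible_iff F N _).2 hθ)))
  refine ⟨_, h₄, hθ', ?_, hC, hγ, hL, fun P => ?_⟩
  · rw [datumOfRecord₁₃SepCoPH_pinW F N _ h₃, datumOfRecord₁₃SepCoPH_pinZ F N _ h₂, datumOfRecord₁₃SepCoPH_pinY F N _ h₁, datumOfRecord₁₃SepCoPH_pinB10 F N θ h]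
  · rw [hup P, Stage13HParams.view₁₃CoPHB10YZW_eq]

/-- … hence EVERY admissible Stage-13 parameter with v1.7 provisos presents a ₁₃CSepCoPH record at its own datum whose world is bound over the FOUR-PIN CoPH view
(package EXPOSED: any floor `Mstar`, operator layer `ops`, [B11] layer `ζ`, [IV] layer `lamW`), any window, block size `θ.L`. [cite: Balaban1989LargeFieldII, Thm 1 + (0.1) pp.355–356 (bookkeeping)] -/
theorem exists_world_isRecordOfRecord₁₃CSepCoPH_view₁₃CoPHB10YZW (h : θ.Provisos₁₃SepCoPH F N) (hθ : θ.Admissible F N) (Mstar : ℕ) (ops : OpsY N θ.toStage3Params Mstar)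
    (ζ : ResidZ F N) (lamW : ResidW F N) {γw : ℝ} (hγw : 0 < γw ∧ γw ≤ θ.γ) :
    ∃ w : WorldP, IsRecordOfRecord₁₃CSepCoPH F N (datumOfRecord₁₃SepCoPH F N θ h) w ∧ w.γ = γw ∧ w.L = (θ.L : ℝ) ∧
      ∀ P, w.up P = upOfRecord₅C F N (θ.view₁₃CoPHB10YZW F N Mstar ops ζ lamW) P := by
  obtain ⟨w₀⟩ := nonempty_worldP
  exact ⟨{ w₀ with
      C := (datumOfRecord₁₃SepCoPH F N θ h).C, γ := γw, L := (θ.L : ℝ), one_lt_L := by exact_mod_cast θ.hL.2,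
      up := fun P => upOfRecord₅C F N (θ.view₁₃CoPHB10YZW F N Mstar ops ζ lamW) P },
    isRecordOfRecord₁₃CSepCoPH_view₁₃CoPHB10YZW_of_eq θ h hθ Mstar ops ζ lamW _ rfl hγw rfl (fun _ => rfl), rfl, rfl, fun _ => rfl⟩

end PinFaces

/-! ## §2 THE ∃-CURRENCY OF THE rev-24 NODES STUB — N08's conjunct at the v1.7 record, the guard riding on `θ`, and the rung-1 PIN `PrintedUV3V N θ.L` -/

section Currency

/-- **AT THE DATUM OF ANY ADMISSIBLE STAGE-13 TUPLE WITH v1.7 PROVISOS, a world (any window height `γw`, block size `θ.L`) that IS a ₁₃CSepCoPH record of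
`datumOfRecord₁₃SepCoPH F N θ h`, bound over the [B10]-PINNED CoPH view, carrying N08 at every run — from the one slot instance `PrintedUV3V N θ.L`** (§0b + the CoPH storey's
proviso-free pointed closer `N08AtRecord13CoPH.b10_main_of_up_pinB10`). [cite: Balaban1985UV3, Thm 1 p.257, Thm 2 p.272; Balaban1989LargeFieldII, Thm 1 + (0.1) pp.355–356 (the record's world; bookkeeping)] -/
theorem exists_world₁₃CSepCoPH_b10_main_of_slot (θ : Stage13HParams F N) (h : θ.Provisos₁₃SepCoPH F N) (hθ : θ.Admissible F N) {γw : ℝ} (hγw : 0 < γw ∧ γw ≤ θ.γ)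
    (hUV : PrintedUV3V N θ.L) :
    ∃ w : WorldP, IsRecordOfRecord₁₃CSepCoPH F N (datumOfRecord₁₃SepCoPH F N θ h) w ∧ w.γ = γw ∧ w.L = (θ.L : ℝ) ∧
      (∀ P, w.up P = upOfRecord₅C F N ((θ.pinB10 F N).toStage5₁₃CoPH F N) P) ∧ ∀ P : B12.RunParams, Dag.B10_main (leavesP w P) := by
  obtain ⟨w, hR, hγ, hL, hup⟩ := exists_world_isRecordOfRecord₁₃CSepCoPH_pinB10 θ h hθ hγw
  exact ⟨w, hR, hγ, hL, hup, b10_main_of_up_pinB10 θ hup hUV⟩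

/-- **The four-pin twin** (package EXPOSED): at the same datum a world bound over `θ.view₁₃CoPHB10YZW Mstar ops ζ lamW` that IS a ₁₃CSepCoPH record and carries N08 at every run,
from `PrintedUV3V N θ.L` — the world at which the other nodes' pointed closers over the four-pin view apply. [cite: Balaban1985UV3, Thm 1 p.257, Thm 2 p.272; Balaban1989LargeFieldII, Thm 1 + (0.1) pp.355–356 (bookkeeping)] -/
theorem exists_world₁₃CSepCoPH_view₁₃CoPHB10YZW_b10_main_of_slot (θ : Stage13HParams F N) (h : θ.Provisos₁₃SepCoPH F N) (hθ : θ.Admissible F N) (Mstar : ℕ)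
    (ops : OpsY N θ.toStage3Params Mstar) (ζ : ResidZ F N) (lamW : ResidW F N) {γw : ℝ} (hγw : 0 < γw ∧ γw ≤ θ.γ) (hUV : PrintedUV3V N θ.L) :
    ∃ w : WorldP, IsRecordOfRecord₁₃CSepCoPH F N (datumOfRecord₁₃SepCoPH F N θ h) w ∧ w.γ = γw ∧ w.L = (θ.L : ℝ) ∧
      (∀ P, w.up P = upOfRecord₅C F N (θ.view₁₃CoPHB10YZW F N Mstar ops ζ lamW) P) ∧ ∀ P : B12.RunParams, Dag.B10_main (leavesP w P) := by
  obtain ⟨w, hR, hγ, hL, hup⟩ := exists_world_isRecordOfRecord₁₃CSepCoPH_view₁₃CoPHB10YZW θ h hθ Mstar ops ζ lamW hγw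
  exact ⟨w, hR, hγ, hL, hup, b10_main_of_up_view₁₃CoPHB10YZW θ Mstar ops ζ lamW hup hUV⟩

/-- **THE PINNED PRESENTATION** at the v1.7 record: from `θ`, its v1.7 provisos, admissibility and guard, and `PrintedUV3V N θ.L` — a presenting
parameter `θ' := θ.pinB10` with provisos `h'`, THE SAME datum (`datumOfRecord₁₃SepCoPH_pinB10`), the guard and admissibility read AT `θ'` (carrier-blind), a world bound over
`θ'.toStage5₁₃CoPH` that IS a ₁₃CSepCoPH record and carries N08 at every run, AND THE PIN READ AT `θ'` (`θ'.L = θ.L`, `rfl`). [cite: Balaban1985UV3, Thm 1 p.257, Thm 2 p.272; Balaban1989LargeFieldII, Thm 1 + (0.1) pp.355–356; Balaban1988Convergent, (3.16)–(3.22) pp.268–269 (the guard; bookkeeping)] -/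
theorem exists_pinned_presentation₁₃CSepCoPH_b10_main (θ : Stage13HParams F N) (h : θ.Provisos₁₃SepCoPH F N) (hθ : θ.Admissible F N)
    (hG : θ.ZhUnity F N ∧ θ.SlotsNondegenerate₁₃ F N) {γw : ℝ} (hγw : 0 < γw ∧ γw ≤ θ.γ) (hUV : PrintedUV3V N θ.L) :
    ∃ (θ' : Stage13HParams F N) (h' : θ'.Provisos₁₃SepCoPH F N) (w : WorldP), (θ'.ZhUnity F N ∧ θ'.SlotsNondegenerate₁₃ F N) ∧ θ'.Admissible F N ∧
      datumOfRecord₁₃SepCoPH F N θ' h' = datumOfRecord₁₃SepCoPH F N θ h ∧ w.C = (datumOfRecord₁₃SepCoPH F N θ' h').C ∧ (0 < w.γ ∧ w.γ ≤ θ'.γ) ∧ w.γ = γw ∧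
      w.L = (θ'.L : ℝ) ∧ (∀ P, w.up P = upOfRecord₅C F N (θ'.toStage5₁₃CoPH F N) P) ∧ IsRecordOfRecord₁₃CSepCoPH F N (datumOfRecord₁₃SepCoPH F N θ h) w ∧
      (∀ P : B12.RunParams, Dag.B10_main (leavesP w P)) ∧ PrintedUV3V N θ'.L := by
  obtain ⟨w, hR, hγ, hL, hup, hN⟩ := exists_world₁₃CSepCoPH_b10_main_of_slot θ h hθ hγw hUV
  refine ⟨θ.pinB10 F N, h.pinB10, w, (N08AtRecord13CoPH.guard_pinB10_iff θ).2 hG, (Stage13Params.pinB10_admissible_iff F N θ.toStage13Params).2 hθ,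
    datumOfRecord₁₃SepCoPH_pinB10 F N θ h, ?_, ?_, hγ, hL, fun P => (hup P).trans (by rw [Stage13HParams.toStage5₁₃CoPH_pinB10]), hR, hN, hUV⟩
  · rw [datumOfRecord₁₃SepCoPH_pinB10 F N θ h]; exact construction_eq_of_isRecordOfRecord₁₃CSepCoPH hR
  · rw [hγ]; exact hγw

/-- **THE FOUR-PIN PRESENTATION** at the v1.7 record (package EXPOSED): presenting parameter `θ' := (((θ.pinB10).pinY (Y9OfRecord …)).pinZ (Z11OfRecord ζ)).pinW
(WOfRecord₁₃ θ lamW)` — THE SAME datum (the four `datumOfRecord₁₃SepCoPH_pin<G>`), guard and admissibility read AT `θ'` (pin-blind), a world bound over `θ'.toStage5₁₃CoPH`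
(= `θ.view₁₃CoPHB10YZW …`, `view₁₃CoPHB10YZW_eq`) that IS a ₁₃CSepCoPH record of `datumOfRecord₁₃SepCoPH θ h` and carries N08 at every run — from `PrintedUV3V N θ.L`, WITH THE PIN READ AT `θ'`.
[cite: Balaban1985UV3, Thm 1 p.257, Thm 2 p.272; Balaban1989LargeFieldII, Thm 1 + (0.1) pp.355–356; Balaban1988Convergent, (3.16)–(3.22) pp.268–269 (bookkeeping)] -/
theorem exists_pinned4_presentation₁₃CSepCoPH_b10_main (θ : Stage13HParams F N) (h : θ.Provisos₁₃SepCoPH F N) (hθ : θ.Admissible F N)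
    (hG : θ.ZhUnity F N ∧ θ.SlotsNondegenerate₁₃ F N) (Mstar : ℕ) (ops : OpsY N θ.toStage3Params Mstar) (ζ : ResidZ F N) (lamW : ResidW F N) {γw : ℝ}
    (hγw : 0 < γw ∧ γw ≤ θ.γ) (hUV : PrintedUV3V N θ.L) :
    ∃ (θ' : Stage13HParams F N) (h' : θ'.Provisos₁₃SepCoPH F N) (w : WorldP), (θ'.ZhUnity F N ∧ θ'.SlotsNondegenerate₁₃ F N) ∧ θ'.Admissible F N ∧
      datumOfRecord₁₃SepCoPH F N θ' h' = datumOfRecord₁₃SepCoPH F N θ h ∧ w.C = (datumOfRecord₁₃SepCoPH F N θ' h').C ∧ (0 < w.γ ∧ w.γ ≤ θ'.γ) ∧ w.γ = γw ∧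
      w.L = (θ'.L : ℝ) ∧ (∀ P, w.up P = upOfRecord₅C F N (θ'.toStage5₁₃CoPH F N) P) ∧ (∀ P, w.up P = upOfRecord₅C F N (θ.view₁₃CoPHB10YZW F N Mstar ops ζ lamW) P) ∧
      IsRecordOfRecord₁₃CSepCoPH F N (datumOfRecord₁₃SepCoPH F N θ h) w ∧ (∀ P : B12.RunParams, Dag.B10_main (leavesP w P)) ∧ PrintedUV3V N θ'.L := by
  obtain ⟨w, hR, hγ, hL, hup, hN⟩ := exists_world₁₃CSepCoPH_view₁₃CoPHB10YZW_b10_main_of_slot θ h hθ Mstar ops ζ lamW hγw hUV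
  have h₁ : (θ.pinB10 F N).Provisos₁₃SepCoPH F N := h.pinB10
  have h₂ : ((θ.pinB10 F N).pinY F N (Y9OfRecord N θ.toStage3Params Mstar ops)).Provisos₁₃SepCoPH F N := h₁.pinY _
  have h₃ : (((θ.pinB10 F N).pinY F N (Y9OfRecord N θ.toStage3Params Mstar ops)).pinZ F N (Z11OfRecord F N ζ)).Provisos₁₃SepCoPH F N := h₂.pinZ _
  have h₄ : ((((θ.pinB10 F N).pinY F N (Y9OfRecord N θ.toStage3Params Mstar ops)).pinZ F N (Z11OfRecord F N ζ)).pinW F N (WOfRecord₁₃ F N θ.toStage13Params lamW)).Provisos₁₃SepCoPH F N :=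
    h₃.pinW _
  have hD : datumOfRecord₁₃SepCoPH F N _ h₄ = datumOfRecord₁₃SepCoPH F N θ h := by
    rw [datumOfRecord₁₃SepCoPH_pinW F N _ h₃, datumOfRecord₁₃SepCoPH_pinZ F N _ h₂, datumOfRecord₁₃SepCoPH_pinY F N _ h₁, datumOfRecord₁₃SepCoPH_pinB10 F N θ h]
  refine ⟨_, h₄, w,
    (N08AtRecord13CoPH.guard_pinW_iff _ _).2 ((N08AtRecord13CoPH.guard_pinZ_iff _ _).2 ((N08AtRecord13CoPH.guard_pinY_iff _ _).2 ((N08AtRecord13CoPH.guard_pinB10_iff θ).2 hG))),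
    (Stage13Params.pinW_admissible_iff F N _ _).2 ((Stage13Params.pinZ_admissible_iff F N _ _).2
      ((Stage13Params.pinY_admissible_iff F N _ _).2 ((Stage13Params.pinB10_admissible_iff F N _).2 hθ))),
    hD, ?_, ?_, hγ, hL, fun P => (hup P).trans (by rw [Stage13HParams.view₁₃CoPHB10YZW_eq]), hup, hR, hN, hUV⟩
  · rw [hD]; exact construction_eq_of_isRecordOfRecord₁₃CSepCoPH hR
  · rw [hγ]; exact hγw

/-- **«THE K0 ANTECEDENT (v1.7 key) ⟹ N08's CONJUNCT OF RUNG 1, WITH ITS PIN»**, generic `N`: from `∃ θ, Provisos₁₃SepCoPH ∧ (ZhUnity ∧ SlotsNondegenerate₁₃) ∧ Admissible` at `F`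
(HYPOTHESIS `hI`, the guard bundled as ONE conjunct and carried to the SAME `θ` untouched) and the slot of record at every odd `L > 1` (HYPOTHESIS `hUV`, the node's object
gap), SOME guarded admissible tuple `θ`, v1.7 provisos `h` and world `w` with `IsRecordOfRecord₁₃CSepCoPH F N (datumOfRecord₁₃SepCoPH F N θ h) w`, `Dag.B10_main` at every
run (`γw := θ.γ`), AND `PrintedUV3V N θ.L` (plan's rung-1 pin, read at this `θ`).  NOT the stub (twelve conjuncts missing), NOT a discharge. [cite: Balaban1985UV3, Thm 1 p.257, Thm 2 p.272; Balaban1989LargeFieldII, Thm 1 + (0.1) pp.355–356; Balaban1988Convergent, (3.16)–(3.22) pp.268–269 (bookkeeping)] -/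
theorem exists_guarded_record₁₃CSepCoPH_b10_main_of_inhabited13SepCoPH
    (hI : ∃ θ : Stage13HParams F N, θ.Provisos₁₃SepCoPH F N ∧ (θ.ZhUnity F N ∧ θ.SlotsNondegenerate₁₃ F N) ∧ θ.Admissible F N)
    (hUV : ∀ L : ℕ, Odd L → 1 < L → PrintedUV3V N L) :
    ∃ (θ : Stage13HParams F N) (h : θ.Provisos₁₃SepCoPH F N) (w : WorldP), (θ.ZhUnity F N ∧ θ.SlotsNondegenerate₁₃ F N) ∧ θ.Admissible F N ∧
      IsRecordOfRecord₁₃CSepCoPH F N (datumOfRecord₁₃SepCoPH F N θ h) w ∧ (∀ P : B12.RunParams, Dag.B10_main (leavesP w P)) ∧ PrintedUV3V N θ.L := by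
  obtain ⟨θ, h, hG, hθ⟩ := hI
  have hUVθ : PrintedUV3V N θ.L := hUV θ.L θ.hL.1 θ.hL.2
  obtain ⟨w, hR, -, -, -, hN⟩ := exists_world₁₃CSepCoPH_b10_main_of_slot θ h hθ ⟨hθ.toStage9.gamma_pos, le_rfl⟩ hUVθ
  exact ⟨θ, h, w, hG, hθ, hR, hN, hUVθ⟩

/-- **THE SAME AT THE GROUP OF RECORD `N = 2`, hypothesis = the rev-24 K0⁷ text** (item stmt-QuantumFields-20541 `Record13SepCoPHInhabited`, `Theses/BalabanUVNodes.lean` rev 24 :469–470 = the ⁶ body at `F` under T₇ —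
`∃ θ : Stage13HParams F 2, θ.Provisos₁₃SepCoPH F 2 ∧ (θ.ZhUnity F 2 ∧ θ.SlotsNondegenerate₁₃ F 2) ∧ θ.Admissible F 2`): N08's conjunct of rung 1 (`NodesAtSomeRecord13PWS` less the S-class, cf. §2S)
from it and the slot at every odd `L > 1`, with the pin `PrintedUV3V 2 θ.L`.  NOT the stub, NOT a discharge. [cite: Balaban1985UV3, Thm 1 p.257, Thm 2 p.272; Balaban1989LargeFieldII, Thm 1 + (0.1) pp.355–356 (bookkeeping)] -/
theorem exists_guarded_record₁₃CSepCoPH_b10_main_of_inhabited13SepCoPH_two (F : T4Family)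
    (hI : ∃ θ : Stage13HParams F 2, θ.Provisos₁₃SepCoPH F 2 ∧ (θ.ZhUnity F 2 ∧ θ.SlotsNondegenerate₁₃ F 2) ∧ θ.Admissible F 2)
    (hUV : ∀ L : ℕ, Odd L → 1 < L → PrintedUV3V 2 L) :
    ∃ (θ : Stage13HParams F 2) (h : θ.Provisos₁₃SepCoPH F 2) (w : WorldP), (θ.ZhUnity F 2 ∧ θ.SlotsNondegenerate₁₃ F 2) ∧ θ.Admissible F 2 ∧
      IsRecordOfRecord₁₃CSepCoPH F 2 (datumOfRecord₁₃SepCoPH F 2 θ h) w ∧ (∀ P : B12.RunParams, Dag.B10_main (leavesP w P)) ∧ PrintedUV3V 2 θ.L :=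
  exists_guarded_record₁₃CSepCoPH_b10_main_of_inhabited13SepCoPH hI hUV

end Currency

/-! ## §2S THE S-BOUND PRESENTATION — N08's slice of plan's REGISTERED rung 1 v5 `NodesAtSomeRecord13PWS` (v3.1: the world is bound to the S-BOUND record class `RecordS` = def-T's
`IsRecordOfRecord₁₃CSepCoPH` with ONE token changed, `upOfRecord₅C ↦ upOfRecord₅CS` — node00-def `Node00/CarriersB8.lean` :288, the C-binding `.withB8 (B8LeafRS …)`; plan g69 PROBE-K1V4-HOST
l.19452, `D69-REV22/dryrun-skel/K1Skeleton13SepCoPHv5.lean`; the tree twin `IsRecordOfRecord₁₃CSepCoPHS` is WANTED there — until it lands the class is spelled INLINE here, verbatim at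
generic `N`).  The S-binding re-binds `b8` only, so N08 at the S-bound [B10]-pinned world is the CoPH storey's `b10_main_of_upS_pinB10` (`Iff.rfl` through `withB8`) -/

section CurrencyS

/-- **AT THE v1.7 DATUM OF ANY ADMISSIBLE STAGE-13 TUPLE WITH THE v1.7 PROVISOS, an S-BOUND world (block size `θ.L`, window `θ.γ`) IN THE S-CLASS OF `datumOfRecord₁₃SepCoPH F N θ h`
(presenting parameter `θ' := θ.pinB10`: admissibility read at it, THE SAME datum by `datumOfRecord₁₃SepCoPH_pinB10`, the S-binding of record over `θ'.toStage5₁₃CoPH`), carrying N08 at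
every run — from the one slot instance `PrintedUV3V N θ.L`** (the S-class text = plan's `RecordS` ∕ WANTED `IsRecordOfRecord₁₃CSepCoPHS`, inlined).
[cite: Balaban1985UV3, Thm 1 p.257, Thm 2 p.272; Balaban1989LargeFieldII, Thm 1 + (0.1) pp.355–356; Balaban1985RegularSpaces, Thm 8 p.101 (the S-binding's `b8`; bookkeeping)] -/
theorem exists_worldS₁₃CSepCoPH_b10_main_of_slot (θ : Stage13HParams F N) (h : θ.Provisos₁₃SepCoPH F N) (hθ : θ.Admissible F N) (hUV : PrintedUV3V N θ.L) :
    ∃ w : WorldP,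
      (∃ (θ' : Stage13HParams F N) (h' : θ'.Provisos₁₃SepCoPH F N), θ'.Admissible F N ∧
        datumOfRecord₁₃SepCoPH F N θ h = datumOfRecord₁₃SepCoPH F N θ' h' ∧ w.C = (datumOfRecord₁₃SepCoPH F N θ h).C ∧ (0 < w.γ ∧ w.γ ≤ θ'.γ) ∧
        w.L = (θ'.L : ℝ) ∧ ∀ P : B12.RunParams, w.up P = upOfRecord₅CS F N (θ'.toStage5₁₃CoPH F N) P) ∧
      ∀ P : B12.RunParams, Dag.B10_main (leavesP w P) := by
  obtain ⟨w₀⟩ := nonempty_worldP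
  refine ⟨{ w₀ with
      C := (datumOfRecord₁₃SepCoPH F N θ h).C, γ := θ.γ, L := (θ.L : ℝ), one_lt_L := by exact_mod_cast θ.hL.2,
      up := fun P => upOfRecord₅CS F N ((θ.pinB10 F N).toStage5₁₃CoPH F N) P }, ⟨θ.pinB10 F N, h.pinB10,
    (Stage13Params.pinB10_admissible_iff F N θ.toStage13Params).2 hθ, (datumOfRecord₁₃SepCoPH_pinB10 F N θ h).symm, rfl, ⟨hθ.toStage9.gamma_pos, le_rfl⟩, rfl, fun _ => rfl⟩, ?_⟩
  exact b10_main_of_upS_pinB10 θ (fun _ => rfl) hUV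

/-- **«THE K0⁷ ANTECEDENT ⟹ N08's SLICE OF THE REGISTERED RUNG 1 v5 `NodesAtSomeRecord13PWS`»**, `N = 2`: from `∃ θ, Provisos₁₃SepCoPH ∧ (ZhUnity ∧ SlotsNondegenerate₁₃) ∧ Admissible` at `F`
(HYPOTHESIS `hI` = the K0⁷ body at `F` VERBATIM, item stmt-QuantumFields-20541; rung 1 v5 = K1⁷ stmt-QuantumFields-20542's registered skeleton) and the slot of record at every odd `L > 1` (HYPOTHESIS `hUV`, N08's object gap): SOME guarded admissible `θ`, provisos `h` and world `w` with
`w` IN THE S-CLASS OF `datumOfRecord₁₃SepCoPH F 2 θ h` (plan's `RecordS F θ h w`, inlined), `Dag.B10_main` at every run, AND the pin `PrintedUV3V 2 θ.L` — i.e. rung 1 v5's text with the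
twelve other node conjuncts and the N12 selector conjunct removed.  NOT the stub, NOT a discharge. [cite: Balaban1985UV3, Thm 1 p.257, Thm 2 p.272; Balaban1989LargeFieldII, Thm 1 + (0.1) pp.355–356; Balaban1988Convergent, (3.16)–(3.22) pp.268–269 (bookkeeping)] -/
theorem exists_guarded_recordS₁₃CSepCoPH_b10_main_of_inhabited13SepCoPH_two (F : T4Family)
    (hI : ∃ θ : Stage13HParams F 2, θ.Provisos₁₃SepCoPH F 2 ∧ (θ.ZhUnity F 2 ∧ θ.SlotsNondegenerate₁₃ F 2) ∧ θ.Admissible F 2)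
    (hUV : ∀ L : ℕ, Odd L → 1 < L → PrintedUV3V 2 L) :
    ∃ (θ : Stage13HParams F 2) (h : θ.Provisos₁₃SepCoPH F 2) (w : WorldP), (θ.ZhUnity F 2 ∧ θ.SlotsNondegenerate₁₃ F 2) ∧ θ.Admissible F 2 ∧
      (∃ (θ' : Stage13HParams F 2) (h' : θ'.Provisos₁₃SepCoPH F 2), θ'.Admissible F 2 ∧
        datumOfRecord₁₃SepCoPH F 2 θ h = datumOfRecord₁₃SepCoPH F 2 θ' h' ∧ w.C = (datumOfRecord₁₃SepCoPH F 2 θ h).C ∧ (0 < w.γ ∧ w.γ ≤ θ'.γ) ∧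
        w.L = (θ'.L : ℝ) ∧ ∀ P : B12.RunParams, w.up P = upOfRecord₅CS F 2 (θ'.toStage5₁₃CoPH F 2) P) ∧
      (∀ P : B12.RunParams, Dag.B10_main (leavesP w P)) ∧ PrintedUV3V 2 θ.L := by
  obtain ⟨θ, h, hG, hθ⟩ := hI
  obtain ⟨w, hS, hN⟩ := exists_worldS₁₃CSepCoPH_b10_main_of_slot θ h hθ (hUV θ.L θ.hL.1 θ.hL.2)
  exact ⟨θ, h, w, hG, hθ, hS, hN, hUV θ.L θ.hL.1 θ.hL.2⟩

end CurrencyS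

/-! ## §3 ON THE STAGE-13 WITNESS LINE OF RECORD `θ₁₃ = theta13LiveOfRecord F N` (block size `F.L`, window `γ = 1∕2`) — N08's share costs `PrintedUV3V N F.L`; the guard
is K0a's HYPOTHESIS-FREE row P12 (`Record13LiveSelectorFamily` v1.1) -/

section WitnessLine
variable (F N) (Zr : (p : B12.RunParams) → TkResidualW F N (FluctV N) p.K)
  (Zh : (p : B12.RunParams) → ℕ → (ℕ → Set (Site (F.P p.K) 0)) → (ℕ → Set (Site (F.P p.K) 0)) → TkResidualW F N (FluctV N) p.K)
  (Phih : (p : B12.RunParams) → ℕ → (ℕ → Set (Site (F.P p.K) 0)) → (ℕ → Set (Site (F.P p.K) 0)) → (ℕ → Plaq (F.P p.K) 0 → ℝ))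

/-- **N08's SHARE OF THE rev-24 NODES STUB ON THE WITNESS LINE OF RECORD COSTS THE SINGLE PROP `PrintedUV3V N F.L`** (plus K0's own v1.7 provisos `hP` at `θ₁₃`,
HYPOTHESIS; admissibility is K0a's THEOREM `admissible_theta13LiveOfRecord`): a world of `datumOfRecord₁₃SepCoPH F N θ₁₃ hP` (`w.γ = 1∕2`, `w.L = F.L`), bound over the
[B10]-pinned view of `θ₁₃`, that is a ₁₃CSepCoPH record and carries N08 at every run.  At `N = 2`: [Balaban1985UV3] Thm 1-compact ∧ Thm 2 with their printed ∃-prefix for SU(2)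
at the family's block size `F.L`, at some version of print's transformations. [cite: Balaban1985UV3, Thm 1 p.257, Thm 2 p.272; Balaban1989LargeFieldII, Thm 1 + (0.1) pp.355–356; Balaban1987RG1, (0.21) p.256 (bookkeeping)] -/
theorem exists_world₁₃CSepCoPH_b10_main_at_theta13LiveOfRecord (hP : (⟨⟨theta13LiveOfRecord F N, Zr⟩, Zh, Phih⟩ : Stage13HParams F N).Provisos₁₃SepCoPH F N) (hUV : PrintedUV3V N F.L) :
    ∃ w : WorldP, IsRecordOfRecord₁₃CSepCoPH F N (datumOfRecord₁₃SepCoPH F N (⟨⟨theta13LiveOfRecord F N, Zr⟩, Zh, Phih⟩ : Stage13HParams F N) hP) w ∧ w.γ = 1 / 2 ∧ w.L = (F.L : ℝ) ∧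
      (∀ P, w.up P = upOfRecord₅C F N (((⟨⟨theta13LiveOfRecord F N, Zr⟩, Zh, Phih⟩ : Stage13HParams F N).pinB10 F N).toStage5₁₃CoPH F N) P) ∧
      ∀ P : B12.RunParams, Dag.B10_main (leavesP w P) :=
  exists_world₁₃CSepCoPH_b10_main_of_slot (⟨⟨theta13LiveOfRecord F N, Zr⟩, Zh, Phih⟩ : Stage13HParams F N) hP (admissible_theta13LiveOfRecord F N) (γw := 1 / 2)
    ⟨one_half_pos, (N08AtRecord13.theta13LiveOfRecord_γ F N).symm.le⟩ hUV

/-- **N08's CONJUNCT OF RUNG 1, WITNESSED AT `θ₁₃` OF RECORD, `N = 2`, WITH ITS PIN** — from K0's open rows at the witness (`hP : θ₁₃.Provisos₁₃SepCoPH F 2`, HYPOTHESIS)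
and `PrintedUV3V 2 F.L`: the guard is the DISPLAYED `hZ : ZhUnity` of the H-lift ∕ K0a's HYPOTHESIS-FREE `slotsNondegenerate₁₃_theta13LiveOfRecord_of_hasResiduals` and admissibility
its `admissible_theta13LiveOfRecord`, BY NAME (no proviso row read).  NOT the stub, NOT a discharge. [cite: Balaban1985UV3, Thm 1 p.257, Thm 2 p.272; Balaban1988Convergent, Thm 1 p.262, (3.16)–(3.22) pp.268–269; Balaban1989LargeFieldI, (0.3)–(0.4) p.176 (bookkeeping)] -/
theorem exists_guarded_record₁₃CSepCoPH_b10_main_of_theta13Live_provisosSepCoPH_two (F : T4Family) (Zr : (p : B12.RunParams) → TkResidualW F 2 (FluctV 2) p.K)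
    (Zh : (p : B12.RunParams) → ℕ → (ℕ → Set (Site (F.P p.K) 0)) → (ℕ → Set (Site (F.P p.K) 0)) → TkResidualW F 2 (FluctV 2) p.K)
    (Phih : (p : B12.RunParams) → ℕ → (ℕ → Set (Site (F.P p.K) 0)) → (ℕ → Set (Site (F.P p.K) 0)) → (ℕ → Plaq (F.P p.K) 0 → ℝ)) (hP : (⟨⟨theta13LiveOfRecord F 2, Zr⟩, Zh, Phih⟩ : Stage13HParams F 2).Provisos₁₃SepCoPH F 2)
    (hZ : (⟨⟨theta13LiveOfRecord F 2, Zr⟩, Zh, Phih⟩ : Stage13HParams F 2).ZhUnity F 2) (hUV : PrintedUV3V 2 F.L) :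
    ∃ (θ : Stage13HParams F 2) (h : θ.Provisos₁₃SepCoPH F 2) (w : WorldP), (θ.ZhUnity F 2 ∧ θ.SlotsNondegenerate₁₃ F 2) ∧ θ.Admissible F 2 ∧
      IsRecordOfRecord₁₃CSepCoPH F 2 (datumOfRecord₁₃SepCoPH F 2 θ h) w ∧ (∀ P : B12.RunParams, Dag.B10_main (leavesP w P)) ∧ PrintedUV3V 2 θ.L := by
  obtain ⟨w, hR, -, -, -, hN⟩ := exists_world₁₃CSepCoPH_b10_main_at_theta13LiveOfRecord F 2 Zr Zh Phih hP hUV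
  exact ⟨_, hP, w, ⟨hZ, slotsNondegenerate₁₃_theta13LiveOfRecord_of_hasResiduals F 2⟩,
    admissible_theta13LiveOfRecord F 2, hR, hN, hUV⟩

end WitnessLine

/-! ## §4 AT K0a's STAGE-13 WITNESS FAMILIES — the all-numerics family `θ₁₃(n, ε₂₉)` (`γ = n.γ`) and the two-letter family `θ₁₃(ε₀, ε₂₉)` (`γ = 1∕2`), block size
`F.L`; v1.7 provisos OPAQUE, guard HYPOTHESIS-FREE -/

section Numerics
variable (F : T4Family) (N : ℕ) [NeZero N] (Zr : (p : B12.RunParams) → TkResidualW F N (FluctV N) p.K)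
  (Zh : (p : B12.RunParams) → ℕ → (ℕ → Set (Site (F.P p.K) 0)) → (ℕ → Set (Site (F.P p.K) 0)) → TkResidualW F N (FluctV N) p.K)
  (Phih : (p : B12.RunParams) → ℕ → (ℕ → Set (Site (F.P p.K) 0)) → (ℕ → Set (Site (F.P p.K) 0)) → (ℕ → Plaq (F.P p.K) 0 → ℝ)) {n : Stage12Numerics} {ε₂₉ : ℝ}

/-- **N08's SHARE OF THE rev-24 NODES STUB AT ANY MEMBER `θ₁₃(n, ε₂₉)` COSTS THE SINGLE PROP `PrintedUV3V N F.L`** (plus the member's v1.7 provisos `hP`, HYPOTHESIS, and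
the two displayed signs `n.Pos`, `0 < ε₂₉` under which K0a's `admissible_theta13LiveOfNumerics` gives admissibility): a world of the member's v1.7 datum (`w.γ = n.γ`,
`w.L = F.L`), bound over the [B10]-pinned Stage-13 view of the member, that IS a ₁₃CSepCoPH record and carries N08 at every run (§2 `exists_world₁₃CSepCoPH_b10_main_of_slot`).
[cite: Balaban1985UV3, Thm 1 p.257, Thm 2 p.272; Balaban1989LargeFieldII, Thm 1 + (0.1) pp.355–356; Balaban1987RG1, (0.21) p.256, (2.9) p.266 (bookkeeping)] -/
theorem exists_world₁₃CSepCoPH_b10_main_at_theta13LiveOfNumerics (hn : n.Pos) (hε' : 0 < ε₂₉)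
    (hP : (⟨⟨theta13LiveOfNumerics F N n ε₂₉ (zeta316OfRecord F N n.ν n.τ9.M n.A₁) (RzOfRecord F N) (ZtOfRecord F N), Zr⟩, Zh, Phih⟩ : Stage13HParams F N).Provisos₁₃SepCoPH F N)
    (hUV : PrintedUV3V N F.L) :
    ∃ w : WorldP,
      IsRecordOfRecord₁₃CSepCoPH F N
          (datumOfRecord₁₃SepCoPH F N (⟨⟨theta13LiveOfNumerics F N n ε₂₉ (zeta316OfRecord F N n.ν n.τ9.M n.A₁) (RzOfRecord F N) (ZtOfRecord F N), Zr⟩, Zh, Phih⟩ : Stage13HParams F N) hP) w ∧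
        w.γ = n.γ ∧ w.L = (F.L : ℝ) ∧
        (∀ P, w.up P = upOfRecord₅C F N
          (((⟨⟨theta13LiveOfNumerics F N n ε₂₉ (zeta316OfRecord F N n.ν n.τ9.M n.A₁) (RzOfRecord F N) (ZtOfRecord F N), Zr⟩, Zh, Phih⟩ : Stage13HParams F N).pinB10 F N).toStage5₁₃CoPH F N) P) ∧
        ∀ P : B12.RunParams, Dag.B10_main (leavesP w P) :=
  have hθ := admissible_theta13LiveOfNumerics F N (zeta316OfRecord F N n.ν n.τ9.M n.A₁) (RzOfRecord F N) (ZtOfRecord F N) hn hε'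
  exists_world₁₃CSepCoPH_b10_main_of_slot _ hP hθ (γw := n.γ) ⟨hθ.toStage9.gamma_pos, le_rfl⟩ hUV

/-- **N08's CONJUNCT OF RUNG 1, WITNESSED AT THE MEMBER `θL F n ε₂₉`, `N = 2`, WITH ITS PIN** — from the member's v1.7 provisos (`hP`, HYPOTHESIS), the signs
`n.Pos`, `0 < ε₂₉`, and `PrintedUV3V 2 F.L`: the guard is the DISPLAYED `hZ : ZhUnity` of the H-lift ∕ K0a's HYPOTHESIS-FREE `slotsNondegenerate₁₃_theta13LiveOfNumerics_of_hasResiduals`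
and admissibility its `admissible_theta13LiveOfNumerics`, BY NAME.  NOT the stub, NOT a discharge. [cite: Balaban1985UV3, Thm 1 p.257, Thm 2 p.272; Balaban1988Convergent, Thm 1 p.262, (3.16)–(3.22) pp.268–269; Balaban1989LargeFieldI, (0.3)–(0.4) p.176 (bookkeeping)] -/
theorem exists_guarded_record₁₃CSepCoPH_b10_main_of_theta13Numerics_provisosSepCoPH_two (F : T4Family) (Zr : (p : B12.RunParams) → TkResidualW F 2 (FluctV 2) p.K)
    (Zh : (p : B12.RunParams) → ℕ → (ℕ → Set (Site (F.P p.K) 0)) → (ℕ → Set (Site (F.P p.K) 0)) → TkResidualW F 2 (FluctV 2) p.K)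
    (Phih : (p : B12.RunParams) → ℕ → (ℕ → Set (Site (F.P p.K) 0)) → (ℕ → Set (Site (F.P p.K) 0)) → (ℕ → Plaq (F.P p.K) 0 → ℝ)) {n : Stage12Numerics} {ε₂₉ : ℝ} (hn : n.Pos)
    (hε' : 0 < ε₂₉)
    (hP : (⟨⟨theta13LiveOfNumerics F 2 n ε₂₉ (zeta316OfRecord F 2 n.ν n.τ9.M n.A₁) (RzOfRecord F 2) (ZtOfRecord F 2), Zr⟩, Zh, Phih⟩ : Stage13HParams F 2).Provisos₁₃SepCoPH F 2)
    (hZ : (⟨⟨theta13LiveOfNumerics F 2 n ε₂₉ (zeta316OfRecord F 2 n.ν n.τ9.M n.A₁) (RzOfRecord F 2) (ZtOfRecord F 2), Zr⟩, Zh, Phih⟩ : Stage13HParams F 2).ZhUnity F 2) (hUV : PrintedUV3V 2 F.L) :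
    ∃ (θ : Stage13HParams F 2) (h : θ.Provisos₁₃SepCoPH F 2) (w : WorldP), (θ.ZhUnity F 2 ∧ θ.SlotsNondegenerate₁₃ F 2) ∧ θ.Admissible F 2 ∧
      IsRecordOfRecord₁₃CSepCoPH F 2 (datumOfRecord₁₃SepCoPH F 2 θ h) w ∧ (∀ P : B12.RunParams, Dag.B10_main (leavesP w P)) ∧ PrintedUV3V 2 θ.L := by
  obtain ⟨w, hR, -, -, -, hN⟩ := exists_world₁₃CSepCoPH_b10_main_at_theta13LiveOfNumerics F 2 Zr Zh Phih hn hε' hP hUV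
  exact ⟨_, hP, w, ⟨hZ, slotsNondegenerate₁₃_theta13LiveOfNumerics_of_hasResiduals F 2 n ε₂₉⟩,
    admissible_theta13LiveOfNumerics F 2 _ _ _ hn hε', hR, hN, hUV⟩

/-- **THE SAME AT THE DOOR IMAGE OF node00-def-K0a's CURED PIN OF RECORD, `Stage13HParams.ofHistoryBlind F 2 ⟨θL, ZrOfRecord₁₃ F 2 θL⟩`** (= `ofHistoryBlind (Stage13RParams.ofCured F 2 θL)`,
`rfl`; FILE 17: dag-n11-d's diagonal cure made a definition; FILE 27's door = a v1.6 parameter read as a v1.7 one with history-constant slot — the shape of K0a's ⁷ witnesses): there the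
v1.7 guard `ZhUnity` IS the cured R-lift's `ZrUnity` (def-T's `Stage13RParams.ZrUnity.ofHistoryBlind`) = K0a's `finsum_ζ0_ZrOfRecord₁₃` — HYPOTHESIS-FREE; so N08's conjunct there costs EXACTLY
what it cost at ⁵ ∕ ⁶ — the provisos there (HYPOTHESIS, opaque), the signs, and `PrintedUV3V 2 F.L`.  NOT the stub, NOT a discharge.
[cite: Balaban1985UV3, Thm 1 p.257, Thm 2 p.272; Balaban1988Convergent, (1.11) p.248, (3.16)–(3.22) pp.268–269; Balaban1989LargeFieldI, (0.3)–(0.4) p.176 (bookkeeping)] -/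
theorem exists_guarded_record₁₃CSepCoPH_b10_main_of_theta13Numerics_provisosSepCoPH_two_at_ofHistoryBlind_ZrOfRecord₁₃ (F : T4Family) {n : Stage12Numerics} {ε₂₉ : ℝ} (hn : n.Pos)
    (hε' : 0 < ε₂₉)
    (hP : (Stage13HParams.ofHistoryBlind F 2
      (⟨theta13LiveOfNumerics F 2 n ε₂₉ (zeta316OfRecord F 2 n.ν n.τ9.M n.A₁) (RzOfRecord F 2) (ZtOfRecord F 2),
        ZrOfRecord₁₃ F 2 (theta13LiveOfNumerics F 2 n ε₂₉ (zeta316OfRecord F 2 n.ν n.τ9.M n.A₁) (RzOfRecord F 2) (ZtOfRecord F 2))⟩ : Stage13RParams F 2)).Provisos₁₃SepCoPH F 2)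
    (hUV : PrintedUV3V 2 F.L) :
    ∃ (θ : Stage13HParams F 2) (h : θ.Provisos₁₃SepCoPH F 2) (w : WorldP), (θ.ZhUnity F 2 ∧ θ.SlotsNondegenerate₁₃ F 2) ∧ θ.Admissible F 2 ∧
      IsRecordOfRecord₁₃CSepCoPH F 2 (datumOfRecord₁₃SepCoPH F 2 θ h) w ∧ (∀ P : B12.RunParams, Dag.B10_main (leavesP w P)) ∧ PrintedUV3V 2 θ.L :=
  exists_guarded_record₁₃CSepCoPH_b10_main_of_theta13Numerics_provisosSepCoPH_two F _ _ _ hn hε' hP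
    (Stage13RParams.ZrUnity.ofHistoryBlind fun _ j ω => finsum_ζ0_ZrOfRecord₁₃ j ω) hUV

end Numerics

section Family₂
variable (F : T4Family) (N : ℕ) [NeZero N] (Zr : (p : B12.RunParams) → TkResidualW F N (FluctV N) p.K)
  (Zh : (p : B12.RunParams) → ℕ → (ℕ → Set (Site (F.P p.K) 0)) → (ℕ → Set (Site (F.P p.K) 0)) → TkResidualW F N (FluctV N) p.K)
  (Phih : (p : B12.RunParams) → ℕ → (ℕ → Set (Site (F.P p.K) 0)) → (ℕ → Set (Site (F.P p.K) 0)) → (ℕ → Plaq (F.P p.K) 0 → ℝ)) {ε₀ ε₂₉ : ℝ}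

/-- **N08's SHARE AT ANY MEMBER `θ₁₃(ε₀, ε₂₉)` OF THE TWO-LETTER FAMILY COSTS `PrintedUV3V N F.L`** (plus the member's v1.7 provisos `hP` and the signs `0 < ε₀`,
`0 < ε₂₉`; admissibility is K0a's `admissible_theta13LiveOfFamily₂`): a world of the member's v1.7 datum (`w.γ = 1∕2`, `w.L = F.L`) bound over the [B10]-pinned CoPH view,
a ₁₃CSepCoPH record carrying N08 at every run. [cite: Balaban1985UV3, Thm 1 p.257, Thm 2 p.272; Balaban1989LargeFieldII, Thm 1 + (0.1) pp.355–356; Balaban1987RG1, (1.2) p.260, (2.9) p.266 (bookkeeping)] -/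
theorem exists_world₁₃CSepCoPH_b10_main_at_theta13LiveOfFamily₂ (hε : 0 < ε₀) (hε' : 0 < ε₂₉)
    (hP : (⟨⟨theta13LiveOfFamily₂ F N ε₀ ε₂₉ (zeta316OfRecord F N (numerics7OfFamily ε₀) 1 1) (RzOfRecord F N) (ZtOfRecord F N), Zr⟩, Zh, Phih⟩ : Stage13HParams F N).Provisos₁₃SepCoPH F N)
    (hUV : PrintedUV3V N F.L) :
    ∃ w : WorldP,
      IsRecordOfRecord₁₃CSepCoPH F N
          (datumOfRecord₁₃SepCoPH F N (⟨⟨theta13LiveOfFamily₂ F N ε₀ ε₂₉ (zeta316OfRecord F N (numerics7OfFamily ε₀) 1 1) (RzOfRecord F N) (ZtOfRecord F N), Zr⟩, Zh, Phih⟩ : Stage13HParams F N) hP) w ∧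
        w.γ = 1 / 2 ∧ w.L = (F.L : ℝ) ∧
        (∀ P, w.up P = upOfRecord₅C F N
          (((⟨⟨theta13LiveOfFamily₂ F N ε₀ ε₂₉ (zeta316OfRecord F N (numerics7OfFamily ε₀) 1 1) (RzOfRecord F N) (ZtOfRecord F N), Zr⟩, Zh, Phih⟩ : Stage13HParams F N).pinB10 F N).toStage5₁₃CoPH F N) P) ∧
        ∀ P : B12.RunParams, Dag.B10_main (leavesP w P) :=
  exists_world₁₃CSepCoPH_b10_main_of_slot _ hP (admissible_theta13LiveOfFamily₂ F N _ _ _ hε hε') (γw := 1 / 2)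
    ⟨one_half_pos, (theta13LiveOfFamily₂_γ F N ε₀ ε₂₉ _ _ _).symm.le⟩ hUV

/-- **N08's CONJUNCT OF RUNG 1, WITNESSED AT THE MEMBER `θ₁₃(ε₀, ε₂₉)`, `N = 2`, WITH ITS PIN** — from the member's v1.7 provisos (`hP`, HYPOTHESIS), `0 < ε₀`,
`0 < ε₂₉` and `PrintedUV3V 2 F.L`; the guard is the DISPLAYED `hZ : ZhUnity` of the H-lift ∕ K0a's HYPOTHESIS-FREE `slotsNondegenerate₁₃_theta13LiveOfFamily₂_of_hasResiduals`, admissibility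
its `admissible_theta13LiveOfFamily₂`, BY NAME.  NOT the stub, NOT a discharge. [cite: Balaban1985UV3, Thm 1 p.257, Thm 2 p.272; Balaban1988Convergent, Thm 1 p.262, (3.16)–(3.22) pp.268–269; Balaban1989LargeFieldI, (0.3)–(0.4) p.176 (bookkeeping)] -/
theorem exists_guarded_record₁₃CSepCoPH_b10_main_of_theta13Family₂_provisosSepCoPH_two (F : T4Family) (Zr : (p : B12.RunParams) → TkResidualW F 2 (FluctV 2) p.K)
    (Zh : (p : B12.RunParams) → ℕ → (ℕ → Set (Site (F.P p.K) 0)) → (ℕ → Set (Site (F.P p.K) 0)) → TkResidualW F 2 (FluctV 2) p.K)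
    (Phih : (p : B12.RunParams) → ℕ → (ℕ → Set (Site (F.P p.K) 0)) → (ℕ → Set (Site (F.P p.K) 0)) → (ℕ → Plaq (F.P p.K) 0 → ℝ)) {ε₀ ε₂₉ : ℝ} (hε : 0 < ε₀) (hε' : 0 < ε₂₉)
    (hP : (⟨⟨theta13LiveOfFamily₂ F 2 ε₀ ε₂₉ (zeta316OfRecord F 2 (numerics7OfFamily ε₀) 1 1) (RzOfRecord F 2) (ZtOfRecord F 2), Zr⟩, Zh, Phih⟩ : Stage13HParams F 2).Provisos₁₃SepCoPH F 2)
    (hZ : (⟨⟨theta13LiveOfFamily₂ F 2 ε₀ ε₂₉ (zeta316OfRecord F 2 (numerics7OfFamily ε₀) 1 1) (RzOfRecord F 2) (ZtOfRecord F 2), Zr⟩, Zh, Phih⟩ : Stage13HParams F 2).ZhUnity F 2) (hUV : PrintedUV3V 2 F.L) :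
    ∃ (θ : Stage13HParams F 2) (h : θ.Provisos₁₃SepCoPH F 2) (w : WorldP), (θ.ZhUnity F 2 ∧ θ.SlotsNondegenerate₁₃ F 2) ∧ θ.Admissible F 2 ∧
      IsRecordOfRecord₁₃CSepCoPH F 2 (datumOfRecord₁₃SepCoPH F 2 θ h) w ∧ (∀ P : B12.RunParams, Dag.B10_main (leavesP w P)) ∧ PrintedUV3V 2 θ.L := by
  obtain ⟨w, hR, -, -, -, hN⟩ := exists_world₁₃CSepCoPH_b10_main_at_theta13LiveOfFamily₂ F 2 Zr Zh Phih hε hε' hP hUV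
  exact ⟨_, hP, w, ⟨hZ, slotsNondegenerate₁₃_theta13LiveOfFamily₂_of_hasResiduals F 2 ε₀ ε₂₉⟩,
    admissible_theta13LiveOfFamily₂ F 2 _ _ _ hε hε', hR, hN, hUV⟩

end Family₂

end Summit.QuantumFields.YangMills.BalabanUVNodes.N08AtRecord13SepCoPH

end
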